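import Mathlib
import HarnessLib
import Literature.MathematicalPhysics.QuantumFieldTheory.OSReconstructionNoE1
import Literature.MathematicalPhysics.QuantumFieldTheory.OSPointwiseAnalyticity

/-!
# `CurvatureKernelBound` — stub A3 support: patching local kernels of a translation-invariant functional

Support file for crux `stmt-QuantumFields-11687` (`PencilRigidity.CurvatureKernelBound`), line
`sixteen-charts-analytic-kernel`, stub `KernelOffDiagonal` (A3).  Pure analysis on `(ℝ⁴)²`:

* `exists_differenceKernel_of_local`: a continuous functional `T` on `𝓢((ℝ⁴)², ℂ)`, translation
  invariant on `⁰𝒮`, which near every configuration `(ξ, 0)`, `ξ ≠ 0`, is integration against a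
  continuous local kernel, is near every off-diagonal configuration integration against `K(x₀ - x₁)`
  for ONE function `K` continuous on `ℝ⁴ ∖ 0` (local kernels are unique, and translating a local kernel
  gives a local kernel);
* `integral_rep_of_local`: local representations by a kernel continuous on an open set `Ω` patch to a
  representation of `T` on all compactly supported test functions supported in `Ω` (smooth partition of
  unity) — registered sub-goal `LocalKernelPatching`.
[folklore]
-/

noncomputable section

open scoped SchwartzMap Manifold ContDiff Topology
open Set MeasureTheory Metric Filter
open Literature.MathematicalPhysics.AQFT Literature.MathematicalPhysics.QuantumLattice
open Literature.MathematicalPhysics.QuantumFieldTheory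

namespace Summit.QuantumFields.YangMills.Theorems.CurvatureKernel

/-- Support criterion for two-point test functions: `supp F ⊆ {x₀ ≠ x₁} ⇒ F ∈ ⁰𝒮`. [folklore] -/
theorem isOffDiagonal_of_tsupport_subset_ne {V : Type*} [NormedAddCommGroup V] [NormedSpace ℝ V]
    {F : 𝓢((Fin 2 → V), ℂ)} (h : tsupport (F : (Fin 2 → V) → ℂ) ⊆ {x | x 0 ≠ x 1}) : IsOffDiagonal F := by
  refine IsOffDiagonal.of_tsupport_subset fun x hx hloc => ?_
  obtain ⟨i, j, hij, hxij⟩ := hloc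
  have h01 : x 0 = x 1 := by
    fin_cases i <;> fin_cases j
    · exact absurd rfl hij
    · exact hxij
    · exact hxij.symm
    · exact absurd rfl hij
  exact h hx h01

/-! ## Local kernels of a translation-invariant functional form a difference kernel -/

/-- **Local kernels of a translation-invariant functional form a difference kernel.** Let `T` be a
continuous functional on `𝓢((ℝ⁴)², ℂ)`, translation invariant on `⁰𝒮`, and suppose that near every
configuration `(ξ, 0)` with `ξ ≠ 0` it is integration against a kernel continuous on a product of
balls. Then `K(ξ) := k^{(ξ,0)}(ξ, 0)` is continuous on `ℝ⁴ ∖ 0`, and near every off-diagonal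
configuration `T` is integration against `K(x₀ - x₁)`: two continuous local kernels of `T` agree where
both are defined, and the translate of a local kernel is a local kernel of `T ∘ τ = T`. [folklore] -/
theorem exists_differenceKernel_of_local
    (T : 𝓢((Fin 2 → EuclideanSpace ℝ (Fin 4)), ℂ) →L[ℂ] ℂ)
    (hT : ∀ (a : EuclideanSpace ℝ (Fin 4)) (F : 𝓢((Fin 2 → EuclideanSpace ℝ (Fin 4)), ℂ)),
      IsOffDiagonal F → T (translateMulti a F) = T F)
    (hloc : ∀ ξ : EuclideanSpace ℝ (Fin 4), ξ ≠ 0 →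
      ∃ (ρ : ℝ) (k : (Fin 2 → EuclideanSpace ℝ (Fin 4)) → ℂ), 0 < ρ ∧
        ContinuousOn k {x | x 0 ∈ ball ξ ρ ∧ x 1 ∈ ball 0 ρ} ∧
        ∀ F : 𝓢((Fin 2 → EuclideanSpace ℝ (Fin 4)), ℂ),
          tsupport (F : (Fin 2 → EuclideanSpace ℝ (Fin 4)) → ℂ) ⊆ {x | x 0 ∈ ball ξ ρ ∧ x 1 ∈ ball 0 ρ} →
          Integrable (fun x => k x * F x) ∧ T F = ∫ x, k x * F x) :
    ∃ K : EuclideanSpace ℝ (Fin 4) → ℂ, ContinuousOn K {x | x ≠ 0} ∧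
      ∀ z : Fin 2 → EuclideanSpace ℝ (Fin 4), z 0 ≠ z 1 → ∃ ρ : ℝ, 0 < ρ ∧
        ∀ F : 𝓢((Fin 2 → EuclideanSpace ℝ (Fin 4)), ℂ),
          tsupport (F : (Fin 2 → EuclideanSpace ℝ (Fin 4)) → ℂ) ⊆ {x | x 0 ∈ ball (z 0) ρ ∧ x 1 ∈ ball (z 1) ρ} →
          T F = ∫ x, K (x 0 - x 1) * F x := by
  choose ρ k hρ hk hrep using hloc
  have hWopen : ∀ (c₀ c₁ : EuclideanSpace ℝ (Fin 4)) (r : ℝ),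
      IsOpen {x : Fin 2 → EuclideanSpace ℝ (Fin 4) | x 0 ∈ ball c₀ r ∧ x 1 ∈ ball c₁ r} := fun c₀ c₁ r =>
    ((isOpen_ball (x := c₀) (ε := r)).preimage
      (continuous_apply 0 : Continuous fun x : Fin 2 → EuclideanSpace ℝ (Fin 4) => x 0)).and
      ((isOpen_ball (x := c₁) (ε := r)).preimage
        (continuous_apply 1 : Continuous fun x : Fin 2 → EuclideanSpace ℝ (Fin 4) => x 1))
  let K : EuclideanSpace ℝ (Fin 4) → ℂ := fun ξ => if h : ξ ≠ 0 then k ξ h ![ξ, 0] else 0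
  -- the local kernel at `(ξ₀, 0)` is `K(y₀ - y₁)` on its whole domain (off the diagonal)
  have claimB : ∀ (ξ₀ : EuclideanSpace ℝ (Fin 4)) (h₀ : ξ₀ ≠ 0) (y : Fin 2 → EuclideanSpace ℝ (Fin 4)),
      y 0 ∈ ball ξ₀ (ρ ξ₀ h₀) → y 1 ∈ ball 0 (ρ ξ₀ h₀) → y 0 ≠ y 1 → k ξ₀ h₀ y = K (y 0 - y 1) := by
    intro ξ₀ h₀ y hy0 hy1 hy
    have hζ : y 0 - y 1 ≠ 0 := sub_ne_zero.2 hy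
    simp only [K, dif_pos hζ]
    set cw : Fin 2 → EuclideanSpace ℝ (Fin 4) := fun _ => y 1 with hcw
    set W₀ : Set (Fin 2 → EuclideanSpace ℝ (Fin 4)) :=
      {x | x 0 ∈ ball ξ₀ (ρ ξ₀ h₀) ∧ x 1 ∈ ball 0 (ρ ξ₀ h₀)} with hW₀
    set W₁ : Set (Fin 2 → EuclideanSpace ℝ (Fin 4)) :=
      {x | x 0 ∈ ball (y 0 - y 1) (ρ _ hζ) ∧ x 1 ∈ ball 0 (ρ _ hζ)} with hW₁
    set O : Set (Fin 2 → EuclideanSpace ℝ (Fin 4)) := (W₁ ∩ (fun x => x + cw) ⁻¹' W₀) ∩ {x | x 0 ≠ x 1} with hO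
    have hOopen : IsOpen O :=
      ((hWopen _ _ _).inter ((hWopen _ _ _).preimage (continuous_add_const cw))).inter
        (isOpen_ne_fun (continuous_apply 0) (continuous_apply 1))
    have hadd : (![y 0 - y 1, 0] : Fin 2 → EuclideanSpace ℝ (Fin 4)) + cw = y := by
      funext i
      fin_cases i <;> simp [cw]
    have hyO : (![y 0 - y 1, 0] : Fin 2 → EuclideanSpace ℝ (Fin 4)) ∈ O := by
      refine ⟨⟨⟨?_, ?_⟩, ?_⟩, ?_⟩
      · exact mem_ball_self (hρ _ hζ)
      · exact mem_ball_self (hρ _ hζ)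
      · show (![y 0 - y 1, 0] : Fin 2 → EuclideanSpace ℝ (Fin 4)) + cw ∈ W₀
        rw [hadd]
        exact ⟨hy0, hy1⟩
      · simpa using hζ
    have hc1 : ContinuousOn (k _ hζ) O := (hk _ hζ).mono fun x hx => hx.1.1
    have hc2 : ContinuousOn (fun x => k ξ₀ h₀ (x + cw)) O :=
      ((hk ξ₀ h₀).comp (continuous_add_const cw).continuousOn fun x hx => hx.1.2)
    have heq := eqOn_of_forall_integral_mul_eq hOopen hc1 hc2 (fun F hF _ => by
      have hoff : IsOffDiagonal F := isOffDiagonal_of_tsupport_subset_ne (hF.trans fun x hx => hx.2)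
      have h1 : T F = ∫ x, k _ hζ x * F x := (hrep _ hζ F (hF.trans fun x hx => hx.1.1)).2
      have hτ : tsupport ((translateMulti (y 1) F : 𝓢((Fin 2 → EuclideanSpace ℝ (Fin 4)), ℂ)) :
          (Fin 2 → EuclideanSpace ℝ (Fin 4)) → ℂ) ⊆ W₀ := by
        intro x hx
        have h2 := (hF (OSReconstructionNoE1.tsupport_translateMulti_subset (y 1) F hx)).1.2
        have h3 : (fun i => x i - y 1) + cw = x := by funext i; simp [cw]
        simpa only [mem_preimage, h3] using h2
      have h2 : T F = ∫ x, k ξ₀ h₀ x * translateMulti (y 1) F x := by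
        rw [← hT (y 1) F hoff]
        exact (hrep ξ₀ h₀ _ hτ).2
      rw [← h1, h2]
      simp only [translateMulti_apply]
      have h4 : (fun x : Fin 2 → EuclideanSpace ℝ (Fin 4) => k ξ₀ h₀ x * F (fun i => x i - y 1)) =
          fun x => (fun u => k ξ₀ h₀ (u + cw) * F u) (x - cw) := by
        funext x
        have h5 : (fun i => x i - y 1) = x - cw := by funext i; simp [cw]
        simp only [h5, sub_add_cancel]
      rw [h4]
      exact integral_sub_right_eq_self (fun u => k ξ₀ h₀ (u + cw) * F u) cw) hyO
    rw [heq]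
    beta_reduce
    rw [hadd]
  -- continuity of `K` off `0`
  have hKcont : ContinuousOn K {x | x ≠ 0} := by
    intro ξ₀ h₀
    have h₀' : ξ₀ ≠ 0 := h₀
    have hg : ContinuousAt (fun ξ : EuclideanSpace ℝ (Fin 4) => k ξ₀ h₀' ![ξ, 0]) ξ₀ := by
      have hmem : (![ξ₀, 0] : Fin 2 → EuclideanSpace ℝ (Fin 4)) ∈
          {x : Fin 2 → EuclideanSpace ℝ (Fin 4) | x 0 ∈ ball ξ₀ (ρ ξ₀ h₀') ∧ x 1 ∈ ball 0 (ρ ξ₀ h₀')} := by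
        exact ⟨mem_ball_self (hρ ξ₀ h₀'), mem_ball_self (hρ ξ₀ h₀')⟩
      have hvec : Continuous fun ξ : EuclideanSpace ℝ (Fin 4) => (![ξ, 0] : Fin 2 → EuclideanSpace ℝ (Fin 4)) :=
        continuous_id.matrixVecCons continuous_const
      exact ContinuousAt.comp (g := k ξ₀ h₀') (f := fun ξ : EuclideanSpace ℝ (Fin 4) => (![ξ, 0] : Fin 2 → EuclideanSpace ℝ (Fin 4)))
        ((hk ξ₀ h₀').continuousAt ((hWopen _ _ _).mem_nhds hmem)) hvec.continuousAt
    refine (hg.congr_of_eventuallyEq ?_).continuousWithinAt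
    filter_upwards [ball_mem_nhds ξ₀ (lt_min (hρ ξ₀ h₀') (norm_pos_iff.2 h₀'))] with ξ hξ
    rw [mem_ball, lt_min_iff, dist_eq_norm] at hξ
    have hξ0 : ξ ≠ 0 := by
      intro h
      rw [h, zero_sub, norm_neg] at hξ
      exact lt_irrefl _ hξ.2
    have h := claimB ξ₀ h₀' ![ξ, 0] (by rw [mem_ball, dist_eq_norm]; exact hξ.1) (mem_ball_self (hρ ξ₀ h₀')) hξ0
    rw [h]
    simp
  refine ⟨K, hKcont, fun z hz => ?_⟩
  -- local representation near a general off-diagonal configuration, by translation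
  have h₀ : z 0 - z 1 ≠ 0 := sub_ne_zero.2 hz
  have hnpos : 0 < ‖z 0 - z 1‖ := norm_pos_iff.2 h₀
  set ρ' : ℝ := min (ρ _ h₀) (‖z 0 - z 1‖ / 4) with hρ'
  have hρ'ρ : ρ' ≤ ρ _ h₀ := min_le_left _ _
  have hρ'n : ρ' ≤ ‖z 0 - z 1‖ / 4 := min_le_right _ _
  refine ⟨ρ', lt_min (hρ _ h₀) (by positivity), fun F hF => ?_⟩
  have hsep : ∀ x : Fin 2 → EuclideanSpace ℝ (Fin 4), x 0 ∈ ball (z 0) ρ' → x 1 ∈ ball (z 1) ρ' → x 0 ≠ x 1 := by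
    intro x hx0 hx1 heq
    rw [mem_ball, dist_eq_norm] at hx0 hx1
    have h1 : ‖z 0 - z 1‖ ≤ ‖x 0 - z 0‖ + ‖x 1 - z 1‖ := by
      calc ‖z 0 - z 1‖ = ‖(x 1 - z 1) - (x 0 - z 0)‖ := by rw [heq]; congr 1; abel
        _ ≤ ‖x 1 - z 1‖ + ‖x 0 - z 0‖ := norm_sub_le _ _
        _ = ‖x 0 - z 0‖ + ‖x 1 - z 1‖ := add_comm _ _
    linarith
  have hoff : IsOffDiagonal F := isOffDiagonal_of_tsupport_subset_ne fun x hx => hsep x (hF hx).1 (hF hx).2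
  set ca : Fin 2 → EuclideanSpace ℝ (Fin 4) := fun _ => z 1 with hca
  have hshift : ∀ u : Fin 2 → EuclideanSpace ℝ (Fin 4), u 0 ∈ ball (z 0) ρ' → u 1 ∈ ball (z 1) ρ' →
      (u - ca) 0 ∈ ball (z 0 - z 1) (ρ _ h₀) ∧ (u - ca) 1 ∈ ball 0 (ρ _ h₀) := by
    intro u hu0 hu1
    rw [mem_ball, dist_eq_norm] at hu0 hu1
    constructor
    · rw [mem_ball, dist_eq_norm]
      calc ‖(u - ca) 0 - (z 0 - z 1)‖ = ‖u 0 - z 0‖ := by simp only [Pi.sub_apply, ca]; congr 1; abel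
        _ < ρ _ h₀ := hu0.trans_le hρ'ρ
    · rw [mem_ball, dist_eq_norm, sub_zero]
      exact hu1.trans_le hρ'ρ
  have hτ : tsupport ((translateMulti (-z 1) F : 𝓢((Fin 2 → EuclideanSpace ℝ (Fin 4)), ℂ)) :
      (Fin 2 → EuclideanSpace ℝ (Fin 4)) → ℂ) ⊆
      {x | x 0 ∈ ball (z 0 - z 1) (ρ _ h₀) ∧ x 1 ∈ ball 0 (ρ _ h₀)} := by
    intro x hx
    have h2 := hF (OSReconstructionNoE1.tsupport_translateMulti_subset (-z 1) F hx)
    have h3 : (fun i => x i - -z 1) - ca = x := by funext i; simp [ca]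
    have h4 := hshift (fun i => x i - -z 1) h2.1 h2.2
    rw [h3] at h4
    exact h4
  rw [← hT (-z 1) F hoff, (hrep _ h₀ _ hτ).2]
  simp only [translateMulti_apply]
  have h4 : (fun x : Fin 2 → EuclideanSpace ℝ (Fin 4) => k _ h₀ x * F (fun i => x i - -z 1)) =
      fun x => (fun u => k _ h₀ (u - ca) * F u) (x + ca) := by
    funext x
    have h5 : (fun i => x i - -z 1) = x + ca := by funext i; simp [ca]
    simp only [h5, add_sub_cancel_right]
  rw [h4, integral_add_right_eq_self (fun u => k _ h₀ (u - ca) * F u) ca]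
  refine integral_congr_ae (Eventually.of_forall fun u => ?_)
  by_cases hu : u ∈ tsupport (F : (Fin 2 → EuclideanSpace ℝ (Fin 4)) → ℂ)
  · obtain ⟨hs0, hs1⟩ := hshift u (hF hu).1 (hF hu).2
    have hne : (u - ca) 0 ≠ (u - ca) 1 := by
      simp only [Pi.sub_apply, ca, ne_eq, sub_left_inj]
      exact hsep u (hF hu).1 (hF hu).2
    show k _ h₀ (u - ca) * F u = K (u 0 - u 1) * F u
    rw [claimB _ h₀ (u - ca) hs0 hs1 hne]
    simp [ca]
  · show k _ h₀ (u - ca) * F u = K (u 0 - u 1) * F u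
    rw [image_eq_zero_of_notMem_tsupport hu, mul_zero, mul_zero]

/-! ## Patching local representations by a smooth partition of unity -/

/-- **Patching local representations.** Let `T` be a continuous functional on `𝓢((ℝ⁴)², ℂ)`, `κ` a
function continuous on an open set `Ω`, and suppose every point of `Ω` has a neighbourhood `O ⊆ Ω` on
whose compactly supported test functions `T` is integration against `κ`. Then `T F = ∫ κ F` for every
compactly supported `F` with `supp F ⊆ Ω`: cover `supp F` by finitely many such `O`, write
`F = Σᵢ φᵢ F` with a smooth partition of unity `(φᵢ)` subordinate to the cover, and sum. [folklore] -/
theorem integral_rep_of_local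
    (T : 𝓢((Fin 2 → EuclideanSpace ℝ (Fin 4)), ℂ) →L[ℂ] ℂ)
    {Ω : Set (Fin 2 → EuclideanSpace ℝ (Fin 4))} (hΩ : IsOpen Ω)
    (κ : (Fin 2 → EuclideanSpace ℝ (Fin 4)) → ℂ) (hκ : ContinuousOn κ Ω)
    (hloc : ∀ z ∈ Ω, ∃ O : Set (Fin 2 → EuclideanSpace ℝ (Fin 4)), IsOpen O ∧ z ∈ O ∧ O ⊆ Ω ∧
      ∀ F : 𝓢((Fin 2 → EuclideanSpace ℝ (Fin 4)), ℂ),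
        tsupport (F : (Fin 2 → EuclideanSpace ℝ (Fin 4)) → ℂ) ⊆ O →
        HasCompactSupport (F : (Fin 2 → EuclideanSpace ℝ (Fin 4)) → ℂ) → T F = ∫ x, κ x * F x)
    (F : 𝓢((Fin 2 → EuclideanSpace ℝ (Fin 4)), ℂ))
    (hFc : HasCompactSupport (F : (Fin 2 → EuclideanSpace ℝ (Fin 4)) → ℂ))
    (hF : tsupport (F : (Fin 2 → EuclideanSpace ℝ (Fin 4)) → ℂ) ⊆ Ω) :
    Integrable (fun x => κ x * F x) ∧ T F = ∫ x, κ x * F x := by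
  have hint : ∀ G : 𝓢((Fin 2 → EuclideanSpace ℝ (Fin 4)), ℂ),
      HasCompactSupport (G : (Fin 2 → EuclideanSpace ℝ (Fin 4)) → ℂ) →
      tsupport (G : (Fin 2 → EuclideanSpace ℝ (Fin 4)) → ℂ) ⊆ Ω → Integrable (fun x => κ x * G x) :=
    fun G hGc hG => (Literature.Analysis.Complex.continuous_mul_of_continuousOn_of_tsupport_subset hΩ hκ
      G.continuous hG).integrable_of_hasCompactSupport hGc.mul_left
  refine ⟨hint F hFc hF, ?_⟩
  choose O hOopen hzO hOΩ hOrep using hloc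
  -- a finite subcover of `supp F`
  obtain ⟨t, ht⟩ := hFc.elim_finite_subcover (fun z : Ω => O z z.2) (fun z => hOopen z z.2)
    (fun x hx => mem_iUnion.2 ⟨⟨x, hF hx⟩, hzO x (hF hx)⟩)
  have hsub : tsupport (F : (Fin 2 → EuclideanSpace ℝ (Fin 4)) → ℂ) ⊆ ⋃ i : {z // z ∈ t}, O i.1 i.1.2 := by
    intro x hx
    obtain ⟨i, hi, hxi⟩ := mem_iUnion₂.1 (ht hx)
    exact mem_iUnion.2 ⟨⟨i, hi⟩, hxi⟩
  obtain ⟨φ, hφ⟩ := SmoothPartitionOfUnity.exists_isSubordinate 𝓘(ℝ, Fin 2 → EuclideanSpace ℝ (Fin 4))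
    (isClosed_tsupport _) (fun i : {z // z ∈ t} => O i.1 i.1.2) (fun i => hOopen _ _) hsub
  -- the pieces `φᵢ F`
  have hφs : ∀ i, ContDiff ℝ ∞ (fun x => ((φ i x : ℝ) : ℂ)) := fun i =>
    Complex.ofRealCLM.contDiff.comp (contMDiff_iff_contDiff.1 (φ i).contMDiff)
  have hGs : ∀ i, ContDiff ℝ ∞ (fun x => ((φ i x : ℝ) : ℂ) * F x) := fun i => (hφs i).mul (F.smooth _)
  have hGc : ∀ i, HasCompactSupport (fun x => ((φ i x : ℝ) : ℂ) * F x) := fun i => hFc.mul_left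
  set G : {z // z ∈ t} → 𝓢((Fin 2 → EuclideanSpace ℝ (Fin 4)), ℂ) := fun i => (hGc i).toSchwartzMap (hGs i)
    with hGdef
  have hG_apply : ∀ i x, G i x = ((φ i x : ℝ) : ℂ) * F x := fun i x => rfl
  have hGsupp : ∀ i, tsupport (G i : (Fin 2 → EuclideanSpace ℝ (Fin 4)) → ℂ) ⊆ O i.1 i.1.2 := by
    intro i
    refine subset_trans ?_ (hφ i)
    have h1 : tsupport (G i : (Fin 2 → EuclideanSpace ℝ (Fin 4)) → ℂ) ⊆ tsupport (fun x => ((φ i x : ℝ) : ℂ)) := by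
      rw [show ((G i : 𝓢((Fin 2 → EuclideanSpace ℝ (Fin 4)), ℂ)) : (Fin 2 → EuclideanSpace ℝ (Fin 4)) → ℂ) =
        fun x => ((φ i x : ℝ) : ℂ) * F x from funext (hG_apply i)]
      exact tsupport_mul_subset_left
    exact h1.trans (tsupport_comp_subset Complex.ofReal_zero _)
  have hGc' : ∀ i, HasCompactSupport (G i : (Fin 2 → EuclideanSpace ℝ (Fin 4)) → ℂ) := fun i => by
    rw [show ((G i : 𝓢((Fin 2 → EuclideanSpace ℝ (Fin 4)), ℂ)) : (Fin 2 → EuclideanSpace ℝ (Fin 4)) → ℂ) =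
      fun x => ((φ i x : ℝ) : ℂ) * F x from funext (hG_apply i)]
    exact hGc i
  -- `F = Σᵢ φᵢ F`
  have hsum1 : ∀ x ∈ tsupport (F : (Fin 2 → EuclideanSpace ℝ (Fin 4)) → ℂ), ∑ i, φ i x = 1 := fun x hx => by
    rw [← finsum_eq_sum_of_fintype]
    exact φ.sum_eq_one hx
  have hFsum : ∀ x, F x = ∑ i, G i x := by
    intro x
    simp only [hG_apply, ← Finset.sum_mul]
    by_cases hx : x ∈ tsupport (F : (Fin 2 → EuclideanSpace ℝ (Fin 4)) → ℂ)
    · rw [← Complex.ofReal_sum, hsum1 x hx, Complex.ofReal_one, one_mul]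
    · rw [image_eq_zero_of_notMem_tsupport hx, mul_zero]
  have hFeq : F = ∑ i, G i := by
    ext x
    rw [hFsum x, sum_apply]
  have hTi : ∀ i, T (G i) = ∫ x, κ x * G i x := fun i => hOrep i.1 i.1.2 (G i) (hGsupp i) (hGc' i)
  calc T F = ∑ i, T (G i) := by rw [hFeq, map_sum]
    _ = ∑ i, ∫ x, κ x * G i x := Finset.sum_congr rfl fun i _ => hTi i
    _ = ∫ x, ∑ i, κ x * G i x := (integral_finsetSum _ fun i _ =>
        hint (G i) (hGc' i) ((hGsupp i).trans (hOΩ _ _))).symm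
    _ = ∫ x, κ x * F x := by
        refine integral_congr_ae (Eventually.of_forall fun x => ?_)
        simp only [← Finset.mul_sum, ← hFsum x]

/-- **Sub-goal `LocalKernelPatching`** (helper for stub `KernelOffDiagonal`): `integral_rep_of_local`,
registered form. [folklore] -/
theorem LocalKernelPatching : ∀ (T : SchwartzMap (Fin 2 → (EuclideanSpace ℝ (Fin 4))) ℂ →L[ℂ] ℂ) (Ω : Set (Fin 2 → (EuclideanSpace ℝ (Fin 4)))), IsOpen Ω → ∀ (κ : (Fin 2 → (EuclideanSpace ℝ (Fin 4))) → ℂ), ContinuousOn κ Ω → (∀ z ∈ Ω, ∃ O : Set (Fin 2 → (EuclideanSpace ℝ (Fin 4))), IsOpen O ∧ z ∈ O ∧ O ⊆ Ω ∧ ∀ F : SchwartzMap (Fin 2 → (EuclideanSpace ℝ (Fin 4))) ℂ, tsupport (F : (Fin 2 → (EuclideanSpace ℝ (Fin 4))) → ℂ) ⊆ O → HasCompactSupport (F : (Fin 2 → (EuclideanSpace ℝ (Fin 4))) → ℂ) → T F = ∫ x : (Fin 2 → (EuclideanSpace ℝ (Fin 4))), κ x * F x) → ∀ F : SchwartzMap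 (Fin 2 → (EuclideanSpace ℝ (Fin 4))) ℂ, HasCompactSupport (F : (Fin 2 → (EuclideanSpace ℝ (Fin 4))) → ℂ) → tsupport (F : (Fin 2 → (EuclideanSpace ℝ (Fin 4))) → ℂ) ⊆ Ω → MeasureTheory.Integrable (fun x : (Fin 2 → (EuclideanSpace ℝ (Fin 4))) => κ x * F x) ∧ T F = ∫ x : (Fin 2 → (EuclideanSpace ℝ (Fin 4))), κ x * F x := by
  intro T Ω hΩ κ hκ hloc F hFc hF
  exact integral_rep_of_local T hΩ κ hκ hloc F hFc hF

end Summit.QuantumFields.YangMills.Theorems.CurvatureKernel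

end
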